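import Mathlib
import Summits.Ventures.PercRepro2.SevenKernel

/-!
# The twelve-edge Kronecker certificates on seven-vertex skeletons, cover part 10: the skeletons `cov19`, `cov20`
(blind cell PercRepro2, mine-2 g34; `SevenKernel.lean` carries the definitions; the bridge `SevenTyped.HCov_seven`
turns each certificate into (HCOV) on the skeleton for every weight vector)

THE COVER: the 46 skeletons `cov01 … cov46` are a greedy cover (mining/mine-2/code/g34/cover.c) of ALL residual
seven-vertex marked graphs with at most eight edges — every labelled edge set of `K₇` in typer-1 g52's weighted
residual `WReducedB` with `≤ 8` edges (68 with seven edges, 1,694 with eight; census res7.c, two codes) is, up to the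
root swap `a₁ ↔ a₂` and the swap of the unmarked vertices `u ↔ w`, a subgraph of one of them (the rounds 1–46 of
cover200.txt; rounds 1–5 already cover the 68 seven-edge sets).  Marks `(o, a₁, a₂, a₃, b) = (0, 1, 2, 3, 4)`,
unmarked `u = 5`, `w = 6`.  Census twin of every certificate: mining/mine-2/code/g34/typed7.c (exact axis-wise
convolution): positive / zero / maximum class sums in the docstrings, 0 negative on every skeleton.
-/

namespace Summit.Ventures.PercRepro2

namespace Seven

/-- **The cover skeleton `cov19`** (mask `1908278` of `K₇`, cover round 19: 232 residual sets newly covered — 40 with eight edges, 0 with seven):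
the edges `oa₂ oa₃ ou ow a₁u a₁w a₂a₃ a₂b a₃u bu bw uw`. -/
def cov19 : Fin 12 → Fin 7 × Fin 7 :=
  ![(0, 2), (0, 3), (0, 5), (0, 6), (1, 5), (1, 6), (2, 3), (2, 4), (3, 5), (4, 5), (4, 6), (5, 6)]

set_option maxRecDepth 100000 in
/-- **The certificate of `cov19`**: every typed three-copy class sum is `≥ 0`, by one `decide +kernel`
(twin: 1,535,290 positive class sums, 15,241,926 zeros, maximum 30,292, 0 negative). -/
theorem cert_cov19 : Cert cov19 := by
  unfold Cert
  decide +kernel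

/-- **The cover skeleton `cov20`** (mask `1487993` of `K₇`, cover round 20: 224 residual sets newly covered — 28 with eight edges, 0 with seven):
the edges `oa₁ ob ou ow a₁a₂ a₁w a₂b a₂u a₃b a₃w bu uw`. -/
def cov20 : Fin 12 → Fin 7 × Fin 7 :=
  ![(0, 1), (0, 4), (0, 5), (0, 6), (1, 2), (1, 6), (2, 4), (2, 5), (3, 4), (3, 6), (4, 5), (5, 6)]

set_option maxRecDepth 100000 in
/-- **The certificate of `cov20`**: every typed three-copy class sum is `≥ 0`, by one `decide +kernel`
(twin: 752,831 positive class sums, 16,024,385 zeros, maximum 26,508, 0 negative). -/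
theorem cert_cov20 : Cert cov20 := by
  unfold Cert
  decide +kernel

end Seven

end Summit.Ventures.PercRepro2
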